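import Literature.Computability.Complexity.CfgCodes
import HarnessLib

/-!
# Configurations of a standard `TM2` machine as bit strings; one step is in `FP`

Sequel of `CfgCodes.lean`. There the configurations of a standard machine `c : TM2Std.SCode`
are words over the finite block alphabet `Blk c`, and one machine step (`CfgCodes.stepT`), the
normal form of a pre-code (`CfgCodes.normT`) and similar passes are finite-state transductions
over `Blk c`. Here blocks are spelled in bits by a self-delimiting unary code
(`code a = 1^{#a} 0`, `#a` the number of the block in an enumeration of `Blk c`), decoded and
encoded by two more transducers (`decT`, `encT`), so that every block transduction `T` becomes a
string function `bitsFn T : {0,1}* → {0,1}*` which is polynomial-time — `FP` of `Classes.lean` —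
by `FST.polyTimeComputable_eval` (`Transducers.lean`) and composition
(`PolyTimeComputable.comp_holds`, `TimeBoundsProofs.lean`):

* `codeCfg x = (encCfg x).flatMap code` — the bit code of a configuration;
  `length_codeCfg_le` — it is linear in the total stack length;
* `stepFn c ∈ FP` with `stepFn_codeCfg : stepFn c (codeCfg x) = codeCfg (stepTotal c.tm x)`
  (and iterated, `iterate_stepFn_codeCfg`) — **one step of the machine on bit-coded
  configurations is polynomial-time** (Arora–Barak 2009, §1.4, proof of Thm. 1.9: the universal
  machine simulates one step of `M` with polynomial overhead);
* `normFn c ∈ FP` with `normFn_codePre` — the code of the configuration `⟨l, v, S⟩` from the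
  pre-code with empty windows (initial configurations: `codePre_update_k₀` computes the pre-code of
  "input word on the input stack" as a fixed prefix followed by the coded input symbols, the shape
  produced by the one-state transducer `preMapT`);
* `firstFn f ∈ FP` with `firstFn_codeCfg` — reading a function of the header block (label, state,
  top windows: e.g. "halted?", "output symbol") off a coded configuration.

## References

* S. Arora, B. Barak, *Computational Complexity: A Modern Approach*, CUP 2009, §1.4 and proof of
  Thm. 1.9 (efficient universal simulation), Claim 1.5 (alphabet reduction by binary coding).
  [AroraBarak2009]
* J. E. Hopcroft, J. D. Ullman, *Introduction to Automata Theory, Languages, and Computation*,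
  1979, §2.7 (Mealy machines) — through `Transducers.lean`.
-/

noncomputable section

namespace Literature.Computability.Complexity

namespace CfgCodes

open Turing TM2Std TM2Sim

variable (c : SCode)

/-! ### Unary block codes -/

/-- The number of blocks. [folklore] -/
def w : ℕ := Fintype.card (Blk c)

/-- There is at least one block. [folklore] -/
theorem w_pos : 0 < w c := Fintype.card_pos

/-- An enumeration of the blocks. [folklore] -/
def eB : Blk c ≃ Fin (w c) := Fintype.equivFin (Blk c)

/-- **The bit code of a block**: `1^{#a} 0` (self-delimiting, of length `≤ w`).
[cite: AroraBarak2009, Claim 1.5 (coding a larger alphabet in bits)] -/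
def code (a : Blk c) : List Bool := List.replicate (eB c a) true ++ [false]

/-- Codes have length at most `w`. [folklore] -/
theorem length_code_le (a : Blk c) : (code c a).length ≤ w c := by
  simp only [code, List.length_append, List.length_replicate, List.length_singleton]
  exact (eB c a).2

/-- Coded block words have length at most `w` per block. [folklore] -/
theorem length_flatMap_code_le (as : List (Blk c)) : (as.flatMap (code c)).length ≤ w c * as.length := by
  induction as with
  | nil => simp
  | cons a as ih =>
    rw [List.flatMap_cons, List.length_append, List.length_cons, Nat.mul_succ]
    have := length_code_le c a
    omega

/-! ### Decoding and encoding transducers -/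

/-- The zero count. [folklore] -/
def cnt0 : Fin (w c) := ⟨0, w_pos c⟩

/-- **The decoder**: counts `1`s (saturating) and emits the block of the count at each `0`.
[cite: AroraBarak2009, Claim 1.5] -/
def decT : FST (Fin (w c)) Bool (Blk c) where
  init := cnt0 c
  step s b :=
    if b then (if h : s.1 + 1 < w c then (⟨s.1 + 1, h⟩, []) else (s, [])) else (cnt0 c, [(eB c).symm s])
  front _ := []
  keep _ := true

/-- Reading `m` ones from count `i` (without saturating) reaches count `i + m`, emitting nothing.
[folklore] -/
theorem decT_run_replicate (rest : List Bool) :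
    ∀ (m : ℕ) (i : Fin (w c)) (h : i.1 + m < w c),
      (decT c).run i (List.replicate m true ++ rest) = (decT c).run ⟨i.1 + m, h⟩ rest := by
  intro m
  induction m with
  | zero => intro i h; rfl
  | succ m ih =>
    intro i h
    rw [List.replicate_succ, List.cons_append, FST.run_cons]
    have hstep : (decT c).step i true = (⟨i.1 + 1, by omega⟩, []) := by
      simp [decT, show i.1 + 1 < w c by omega]
    rw [hstep]
    dsimp only
    rw [ih ⟨i.1 + 1, by omega⟩ (by simp; omega), List.nil_append]
    have he : (⟨(⟨i.1 + 1, by omega⟩ : Fin (w c)).1 + m, by simp; omega⟩ : Fin (w c)) =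
        ⟨i.1 + (m + 1), h⟩ := Fin.ext (by simp; omega)
    rw [he]

/-- **The decoder reads one code**: from count `0`, on `code a ++ rest` it emits `a` and continues
on `rest` from count `0`. [folklore] -/
theorem decT_run_code (a : Blk c) (rest : List Bool) :
    (decT c).run (cnt0 c) (code c a ++ rest) =
      (((decT c).run (cnt0 c) rest).1, a :: ((decT c).run (cnt0 c) rest).2) := by
  rw [code, List.append_assoc, List.singleton_append,
    decT_run_replicate c (false :: rest) (eB c a) (cnt0 c) (by simp [cnt0]), FST.run_cons]
  have hstep : (decT c).step ⟨(cnt0 c).1 + (eB c a : ℕ), by simp [cnt0]⟩ false = (cnt0 c, [a]) := by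
    simp only [decT, if_false, cnt0, zero_add, Fin.eta, Equiv.symm_apply_apply, Bool.false_eq_true]
  rw [hstep]
  rfl

/-- **Decoding a coded block word gives the word back.** [cite: AroraBarak2009, Claim 1.5] -/
theorem decT_eval_flatMap_code (as : List (Blk c)) : (decT c).eval (as.flatMap (code c)) = as := by
  have hrun : ∀ as : List (Blk c), ((decT c).run (cnt0 c) (as.flatMap (code c))).2 = as := by
    intro as
    induction as with
    | nil => rfl
    | cons a as ih => rw [List.flatMap_cons, decT_run_code, ih]
  simp only [FST.eval, show (decT c).init = cnt0 c from rfl, hrun,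
    show ∀ s, (decT c).keep s = true from fun _ => rfl, show ∀ s, (decT c).front s = [] from fun _ => rfl,
    if_true, List.nil_append]

/-- **One-state transducers**: emit `g a` per symbol and prepend the fixed word `P`.
[folklore] -/
def preMapT {α β : Type} (P : List β) (g : α → List β) : FST Unit α β where
  init := ()
  step _ a := ((), g a)
  front _ := P
  keep _ := true

/-- A one-state transducer computes `P ++ l.flatMap g`. [folklore] -/
theorem preMapT_eval {α β : Type} (P : List β) (g : α → List β) (l : List α) :
    (preMapT P g).eval l = P ++ l.flatMap g := by
  have hrun : ∀ l : List α, ((preMapT P g).run () l).2 = l.flatMap g := by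
    intro l
    induction l with
    | nil => rfl
    | cons a l ih =>
      rw [FST.run_cons, List.flatMap_cons]
      exact congrArg (g a ++ ·) ih
  change (preMapT P g).front ((preMapT P g).run () l).1 ++
      (if (preMapT P g).keep ((preMapT P g).run () l).1 then ((preMapT P g).run () l).2 else []) = _
  rw [hrun l]
  rfl

/-- `z ↦ P ++ z.flatMap g` is in `FP` (over bits). [folklore] -/
theorem preMap_mem_FP (P : List Bool) (g : Bool → List Bool) : (fun z => P ++ z.flatMap g) ∈ FP := by
  obtain ⟨p, M, hM⟩ := (preMapT P g).polyTimeComputable_eval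
  refine ⟨p, M, fun z => ?_⟩
  have h := hM z
  rw [preMapT_eval] at h
  exact h

/-- **The encoder**: the one-state transducer spelling each block in bits. [cite: AroraBarak2009, Claim 1.5] -/
def encT : FST Unit (Blk c) Bool := preMapT [] (code c)

/-- The encoder computes the coded block word. [folklore] -/
theorem encT_eval (as : List (Blk c)) : (encT c).eval as = as.flatMap (code c) := by
  rw [encT, preMapT_eval, List.nil_append]

/-! ### Block transductions as polynomial-time string functions -/

/-- **The string function of a block transduction** `T`: decode, transduce, encode.
[cite: AroraBarak2009, §1.4] -/
def bitsFn {σ : Type} (T : FST σ (Blk c) (Blk c)) : List Bool → List Bool :=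
  fun u => (T.eval ((decT c).eval u)).flatMap (code c)

/-- `bitsFn T` is the composite of the three transductions. [folklore] -/
theorem bitsFn_eq_comp {σ : Type} (T : FST σ (Blk c) (Blk c)) :
    bitsFn c T = (encT c).eval ∘ T.eval ∘ (decT c).eval := by
  funext u; simp [bitsFn, encT_eval]

/-- **Block transductions are polynomial-time on bit strings** (three finite-state transducers
composed). [cite: AroraBarak2009, §1.4 and Claim 1.5] -/
theorem bitsFn_mem_FP {σ : Type} [Fintype σ] (T : FST σ (Blk c) (Blk c)) : bitsFn c T ∈ FP := by
  rw [bitsFn_eq_comp]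
  exact PolyTimeComputable.comp_holds (encT c).polyTimeComputable_eval
    (PolyTimeComputable.comp_holds T.polyTimeComputable_eval (decT c).polyTimeComputable_eval)

/-- On coded block words `bitsFn T` is `T` (coded). [folklore] -/
theorem bitsFn_flatMap_code {σ : Type} (T : FST σ (Blk c) (Blk c)) (as : List (Blk c)) :
    bitsFn c T (as.flatMap (code c)) = (T.eval as).flatMap (code c) := by
  rw [bitsFn, decT_eval_flatMap_code]

/-! ### Coded configurations; one step; normal forms; reading the header -/

/-- **The bit code of a configuration.** [cite: AroraBarak2009, §1.4] -/
def codeCfg (x : c.tm.Cfg) : List Bool := (encCfg c x).flatMap (code c)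

/-- The bit code of a configuration is linear in the total stack length:
`|codeCfg x| ≤ w · (1 + nK + Σ |stacks|)`. [folklore] -/
theorem length_codeCfg_le (x : c.tm.Cfg) :
    (codeCfg c x).length ≤ w c * (1 + c.nK + ∑ k, (x.stk k).length) :=
  (length_flatMap_code_le c _).trans (Nat.mul_le_mul_left _ (length_encCfg_le c x))

/-- **The step function on bit strings.** [cite: AroraBarak2009, §1.4 and proof of Thm. 1.9] -/
def stepFn : List Bool → List Bool := bitsFn c (stepT c)

/-- The step function is in `FP`. [cite: AroraBarak2009, proof of Thm. 1.9 (one simulated step costs polynomial time)] -/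
theorem stepFn_mem_FP : stepFn c ∈ FP := bitsFn_mem_FP c _

/-- **One machine step on bit codes**: `stepFn (codeCfg x) = codeCfg (stepTotal x)`.
[cite: AroraBarak2009, §1.4 and proof of Thm. 1.9] -/
theorem stepFn_codeCfg (x : c.tm.Cfg) : stepFn c (codeCfg c x) = codeCfg c (stepTotal c.tm x) := by
  rw [stepFn, codeCfg, bitsFn_flatMap_code, stepT_eval_encCfg, codeCfg]

/-- Iterated machine steps on bit codes. [cite: AroraBarak2009, proof of Thm. 1.9] -/
theorem iterate_stepFn_codeCfg (x : c.tm.Cfg) (n : ℕ) :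
    (stepFn c)^[n] (codeCfg c x) = codeCfg c ((stepTotal c.tm)^[n] x) := by
  induction n generalizing x with
  | zero => rfl
  | succ n ih => rw [Function.iterate_succ_apply, Function.iterate_succ_apply, stepFn_codeCfg, ih]

/-- **The normalising function on bit strings.** [cite: AroraBarak2009, §1.4] -/
def normFn : List Bool → List Bool := bitsFn c (normT c)

/-- The normalising function is in `FP`. [folklore] -/
theorem normFn_mem_FP : normFn c ∈ FP := bitsFn_mem_FP c _

/-- The bit pre-code with empty windows: header, then the coded bodies. [folklore] -/
def codePre (l : Option (Fin c.nΛ)) (v : Fin c.nσ) (R : Fin c.nK → List (Sym c)) : List Bool :=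
  (preEnc c l v (fun _ => []) R).flatMap (code c)

/-- **Normal form on bit strings**: the pre-code with empty windows and bodies `R` is mapped to
the code of `⟨l, v, R⟩`. [cite: AroraBarak2009, §1.4] -/
theorem normFn_codePre (l : Option (Fin c.nΛ)) (v : Fin c.nσ) (R : Fin c.nK → List (Sym c)) :
    normFn c (codePre c l v R) = codeCfg c ⟨l, v, R⟩ := by
  rw [normFn, codePre, bitsFn_flatMap_code, normT_eval_preEnc_nil, codeCfg]

/-- The pre-code of "word `y` on the input stack, all other stacks empty" is a fixed prefix (the
empty header and `nK` separators) followed by the coded symbols of `y`. [folklore] -/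
theorem codePre_update_k₀ (l : Option (Fin c.nΛ)) (v : Fin c.nσ) (y : List (Sym c)) :
    codePre c l v (Function.update (fun _ => []) c.k₀ y) =
      (code c (Blk.hdr l v (toWin c fun _ => [])) ++ (List.replicate c.nK (code c Blk.sep)).flatten) ++
        y.flatMap (fun g => code c (Blk.sym g)) := by
  rw [codePre, preEnc, bodyOf_update_k₀, List.flatMap_cons, List.flatMap_append, List.append_assoc]
  congr 2
  · induction c.nK with
    | zero => rfl
    | succ n ih => rw [List.replicate_succ, List.replicate_succ, List.flatMap_cons, List.flatten_cons, ih]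
  · induction y with
    | nil => rfl
    | cons g y ih => rw [List.map_cons, List.flatMap_cons, List.flatMap_cons, ih]

/-- **Reading the header**: the transducer emitting `f` of the first block and nothing else.
[folklore] -/
def firstT (f : Blk c → List Bool) : FST Bool (Blk c) Bool where
  init := false
  step s a := if s then (true, []) else (true, f a)
  front _ := []
  keep _ := true

/-- After the first block `firstT` emits nothing. [folklore] -/
theorem firstT_run_true (f : Blk c → List Bool) : ∀ as : List (Blk c), (firstT c f).run true as = (true, []) := by
  intro as
  induction as with
  | nil => rfl
  | cons a as ih => rw [FST.run_cons, show (firstT c f).step true a = (true, []) from rfl]; simp [ih]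

/-- `firstT f` on a nonempty word emits `f` of its first block. [folklore] -/
theorem firstT_eval_cons (f : Blk c → List Bool) (a : Blk c) (as : List (Blk c)) :
    (firstT c f).eval (a :: as) = f a := by
  rw [FST.eval, show (firstT c f).init = false from rfl, FST.run_cons,
    show (firstT c f).step false a = (true, f a) from rfl]
  dsimp only
  rw [firstT_run_true]
  simp [firstT]

/-- **Reading a function of the header block off a bit string.** [folklore] -/
def firstFn (f : Blk c → List Bool) : List Bool → List Bool := (firstT c f).eval ∘ (decT c).eval

/-- `firstFn f` is in `FP`. [folklore] -/
theorem firstFn_mem_FP (f : Blk c → List Bool) : firstFn c f ∈ FP :=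
  PolyTimeComputable.comp_holds (firstT c f).polyTimeComputable_eval (decT c).polyTimeComputable_eval

/-- `firstFn f` on a coded nonempty block word is `f` of the first block. [folklore] -/
theorem firstFn_flatMap_code_cons (f : Blk c → List Bool) (a : Blk c) (as : List (Blk c)) :
    firstFn c f ((a :: as).flatMap (code c)) = f a := by
  rw [firstFn, Function.comp_apply, decT_eval_flatMap_code, firstT_eval_cons]

/-- **`firstFn f` on a coded configuration is `f` of its header** (label, state, top windows).
[cite: AroraBarak2009, §1.4] -/
theorem firstFn_codeCfg (f : Blk c → List Bool) (x : c.tm.Cfg) :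
    firstFn c f (codeCfg c x) = f (Blk.hdr x.l x.var (toWin c x.stk)) := by
  rw [codeCfg, encCfg_eq, firstFn_flatMap_code_cons]

end CfgCodes

end Literature.Computability.Complexity

end
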